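import Literature.AlgebraicGeometry.AbelianSchemes.AbelianSchemePolarization
import Literature.AlgebraicGeometry.AbelianSchemes.AbelianSchemeDualTransport
import HarnessLib

/-!
# Homomorphisms of the fibres of abelian schemes induced by homomorphisms of `S`-group schemes, read on points

Topic `Literature/AlgebraicGeometry/AbelianSchemes`, namespace `Literature.AlgebraicGeometry.AbelianSchemes.AbelianSchemeOver`.
For abelian schemes `A, B` over a base `S`, a homomorphism of `S`-group schemes `f : A → B` (`[IsMonHom f]`) and a
field-valued point `s : Spec Ω → S`, the base change `f_s : A_s → B_s` is a homomorphism of abelian varieties over `Ω`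
([MumfordFogartyKirwan1994] Ch. 6 §1 Def. 6.1, §2 Def. 6.3 «the induced `λ̄ : X̄ → X̂̄`» on geometric fibres;
[GortzWedhorn2020] (4.7) base change, Remark 16.54).  This file is the `Over S`-carrier, two-object version of ★
`AbelianScheme.fibreEnd` (`AbelianSchemeFibreEndomorphisms`) and the homomorphism version of ★ `fibreIsoOfIso`
(`AbelianSchemeDualTransport`):
* `fibreHom f s : (A.fibre s).toAbelianVariety ⟶ (B.fibre s).toAbelianVariety` (ONE definition with body), `fibreHom_hom_hom_hom`
  (rfl: its `Over (Spec Ω)`-morphism is `(Over.pullback s).map f`), `fibreHom_id`, `fibreHom_comp`, `fibreIsoOfIso_hom_eq_fibreHom`;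
* ON POINTS: `fibrePointToLeft_map_fibreHom` (`f_s(P)` lies over `P ≫ f`), `fibrePointToLeft_injective` (an `Ω`-point of `B_s` is
  determined by its point of `B`), `fibrePointToLeft_map_fibreHom_eq_valueAt` (for `λ : A → Â`, the point of `Â` under `λ_s(P)` IS
  `valueAt λ P = λ̄(P)`), hence **`algPointsMap_fibreHom_eq_iff`** (`λ₂,s(Q) = λ₁,s(Q′) ↔ λ̄₂(Q) = λ̄₁(Q′)`) and
  **`finite_ker_fibreHom_of_hasType`** (a polarisation of type `δ` has finitely many `Ω`-points in the kernel of `λ_s`,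
  `Ω` algebraically closed: the kernel on points is `kerPointsAt s ≅ (∏ ℤ/δᵢ)²`, ★ `Polarization.HasType`).
Cell `hodgecm-mathlib`, M1′ W3 leaf (K3-b) for B-p03's § 9 `lamClauseTransportR`; generic, CM-free; no fact, no instance, no sorry.
HC_CM is proved only modulo the printed citations until rung 0 closes.

## References
* [MumfordFogartyKirwan1994] D. Mumford, J. Fogarty, F. Kirwan, *Geometric Invariant Theory*, 3rd ed. (1994), Ch. 6 §1 Def. 6.1
  (p. 115), §2 Def. 6.2–6.3 (p. 120), App. 7A (pp. 234–235).
* [GortzWedhorn2020] U. Görtz, T. Wedhorn, *Algebraic Geometry I*, 2nd ed. (2020), Section (4.7) (p. 135), Remark 16.54 (p. 678).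
* [MumfordAV1970] D. Mumford, *Abelian Varieties* (1970), §13 (the group `K(L)`), §23.
-/

set_option autoImplicit false

universe u

open CategoryTheory CategoryTheory.Limits AlgebraicGeometry MonoidalCategory

noncomputable section

namespace Literature.AlgebraicGeometry.AbelianSchemes

namespace AbelianSchemeOver

open Literature.AlgebraicGeometry.Motives
open scoped MonObj

variable {S : Scheme.{u}} {A B C : AbelianSchemeOver S} {Ω : Type u} [Field Ω]

/-! ### §1 The homomorphism of fibres `f_s : A_s → B_s` -/

/-- **The homomorphism of the fibres `f_s : A_s → B_s` (abelian varieties over `Ω`) induced by a homomorphism of `S`-group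
schemes `f : A → B`** — the cartesian-monoidal base change `(Over.pullback s).mapGrp.map f` read through `InducedCategory.homMk`
(Mumford's «induced `λ̄ : X̄ → X̂̄`» for `f = λ`). [cite: MumfordFogartyKirwan1994, Ch. 6 §2 Definition 6.3 (p. 120)]
[cite: GortzWedhorn2020, Section (4.7) (p. 135) and Remark 16.54 (p. 678)] -/
def fibreHom (f : A.X ⟶ B.X) [IsMonHom f] (s : Spec (.of Ω) ⟶ S) :
    (A.fibre s).toAbelianVariety ⟶ (B.fibre s).toAbelianVariety :=
  InducedCategory.homMk (X := (A.fibre s).toAbelianVariety) (Y := (B.fibre s).toAbelianVariety)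
    ((Over.pullback s).mapGrp.map (Grp.ofHom f))

/-- The underlying morphism of `Ω`-schemes (over `Spec Ω`) of `f_s` is the base change `(Over.pullback s).map f`.
[cite: GortzWedhorn2020, Section (4.7) (p. 135)] -/
@[simp]
theorem fibreHom_hom_hom_hom (f : A.X ⟶ B.X) [IsMonHom f] (s : Spec (.of Ω) ⟶ S) :
    (fibreHom f s).hom.hom.hom = (Over.pullback s).map f := rfl

/-- `(𝟙_A)_s = 𝟙_{A_s}`. [cite: GortzWedhorn2020, Section (4.7) (p. 135)] -/
theorem fibreHom_id (s : Spec (.of Ω) ⟶ S) : fibreHom (𝟙 A.X) s = 𝟙 (A.fibre s).toAbelianVariety := by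
  apply AbelianVariety.hom_ext
  change (Over.pullback s).map (𝟙 A.X) = 𝟙 ((Over.pullback s).obj A.X)
  exact (Over.pullback s).map_id _

/-- `(f ≫ g)_s = f_s ≫ g_s`. [cite: GortzWedhorn2020, Section (4.7) (p. 135)] -/
theorem fibreHom_comp (f : A.X ⟶ B.X) (g : B.X ⟶ C.X) [IsMonHom f] [IsMonHom g] (s : Spec (.of Ω) ⟶ S) :
    fibreHom (f ≫ g) s = fibreHom f s ≫ fibreHom g s := by
  apply AbelianVariety.hom_ext
  rw [fibreHom_hom_hom_hom, Functor.map_comp]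
  rfl

/-- For an ISOMORPHISM `e : A′ ≅ A` of `S`-group schemes, ★ `fibreIsoOfIso e s` is `fibreHom e.hom s`.
[cite: GortzWedhorn2020, Section (4.7) (p. 135)] -/
theorem fibreIsoOfIso_hom_eq_fibreHom {A' : AbelianSchemeOver S} (e : A'.X ≅ A.X) [IsMonHom e.hom]
    (s : Spec (.of Ω) ⟶ S) : (fibreIsoOfIso e s).hom = fibreHom e.hom s :=
  AbelianVariety.hom_ext _ _ rfl

/-- `f_s` over the first projections: `A_s → B_s → B` is `A_s → A → B`. [cite: GortzWedhorn2020, Section (4.7) (p. 135)] -/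
theorem fibreHom_toSchemeHom_fst (f : A.X ⟶ B.X) [IsMonHom f] (s : Spec (.of Ω) ⟶ S) :
    AbelianVariety.Hom.toSchemeHom (fibreHom f s) ≫ pullback.fst B.X.hom s = pullback.fst A.X.hom s ≫ f.left :=
  (congrArg (fun x => x ≫ pullback.fst B.X.hom s) (Over.pullback_map_left s A.X (k := f))).trans (pullback.lift_fst _ _ _)

/-- `f_s` lies over `Spec Ω`. [cite: GortzWedhorn2020, Section (4.7) (p. 135)] -/
theorem fibreHom_toSchemeHom_snd (f : A.X ⟶ B.X) [IsMonHom f] (s : Spec (.of Ω) ⟶ S) :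
    AbelianVariety.Hom.toSchemeHom (fibreHom f s) ≫ pullback.snd B.X.hom s = pullback.snd A.X.hom s :=
  (congrArg (fun x => x ≫ pullback.snd B.X.hom s) (Over.pullback_map_left s A.X (k := f))).trans (pullback.lift_snd _ _ _)

/-! ### §2 `f_s` on `Ω`-points -/

/-- **The point of `B` under `f_s(P)` is the point of `A` under `P`, followed by `f`.**
[cite: MumfordFogartyKirwan1994, Ch. 6 §2 Definition 6.3 (p. 120)] -/
theorem fibrePointToLeft_map_fibreHom (f : A.X ⟶ B.X) [IsMonHom f] (s : Spec (.of Ω) ⟶ S)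
    (P : (A.fibre s).toAbelianVariety.Points Ω) :
    B.fibrePointToLeft s (AlgPoints.map (fibreHom f s).hom.hom.hom P) = A.fibrePointToLeft s P ≫ f.left := by
  change (P ≫ (fibreHom f s).hom.hom.hom).left ≫ pullback.fst B.X.hom s = _
  rw [Over.comp_left, Category.assoc]
  exact (congrArg (fun x => P.left ≫ x) (fibreHom_toSchemeHom_fst f s)).trans (Category.assoc _ _ _).symm

/-- **An `Ω`-point of the fibre `B_s` is determined by its point of `B`** (it is a section of `B_s = B ×_S Spec Ω → Spec Ω`).
[cite: GortzWedhorn2020, Section (4.7) (p. 135)] -/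
theorem fibrePointToLeft_injective (s : Spec (.of Ω) ⟶ S) :
    Function.Injective (B.fibrePointToLeft s : (B.fibre s).toAbelianVariety.Points Ω → (Spec (.of Ω) ⟶ B.X.left)) := by
  intro P Q h
  apply Over.OverMorphism.ext
  apply pullback.hom_ext
  · exact h
  · exact (B.fibrePoint_left_comp_snd s P).trans (B.fibrePoint_left_comp_snd s Q).symm

/-- A homomorphism of abelian varieties sends `1` to `1` on `L`-points (`Hom(Spec L, –)` of a homomorphism of group objects,
Mathlib `IsMonHom.monoidHom`; private helper). [folklore] -/
private theorem algPointsMap_hom_one {K : Type u} [Field K] {X Y : AbelianVariety K} {L : Type u} [Field L] [Algebra K L]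
    (χ : X ⟶ Y) : AlgPoints.map χ.hom.hom.hom (1 : X.Points L) = 1 := by
  have h := map_one (IsMonHom.monoidHom χ.hom.hom.hom (specOver K L))
  simpa only [IsMonHom.monoidHom_apply, AlgPoints.map_apply] using h

variable (A) in
/-- **For `λ : A → Â`, the point of `Â` under `λ_s(P)` is the value `λ̄(P)`** (★ `valueAt`, by definition
`fibrePointToLeft P ≫ λ`). [cite: MumfordFogartyKirwan1994, Ch. 6 §2 Definition 6.3 (p. 120)] -/
theorem fibrePointToLeft_map_fibreHom_eq_valueAt (s : Spec (.of Ω) ⟶ S) (D : A.DualPair) (lam : A.X ⟶ D.hat.X) [IsMonHom lam]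
    (P : (A.fibre s).toAbelianVariety.Points Ω) :
    D.hat.fibrePointToLeft s (AlgPoints.map (fibreHom lam s).hom.hom.hom P) = A.valueAt s D lam P :=
  fibrePointToLeft_map_fibreHom lam s P

variable (A) in
/-- **`λ₂,s(Q) = λ₁,s(Q′)` in `Â_s(Ω)` iff `λ̄₂(Q) = λ̄₁(Q′)` as points of `Â`** — the corollary B-p03's K3 closer consumes
(two homomorphisms `λ₁, λ₂ : A → Â`; with `λ₁ = λ₂` and `Q′ = 1` it reads the kernel of `λ_s` as ★ `kerPointsAt`).
[cite: MumfordFogartyKirwan1994, Ch. 6 §2 Definition 6.3 (p. 120)] -/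
theorem algPointsMap_fibreHom_eq_iff (s : Spec (.of Ω) ⟶ S) (D : A.DualPair) (lam₁ lam₂ : A.X ⟶ D.hat.X)
    [IsMonHom lam₁] [IsMonHom lam₂] (Q Q' : (A.fibre s).toAbelianVariety.Points Ω) :
    AlgPoints.map (fibreHom lam₂ s).hom.hom.hom Q = AlgPoints.map (fibreHom lam₁ s).hom.hom.hom Q' ↔
      A.valueAt s D lam₂ Q = A.valueAt s D lam₁ Q' := by
  rw [← fibrePointToLeft_map_fibreHom_eq_valueAt A s D lam₂ Q, ← fibrePointToLeft_map_fibreHom_eq_valueAt A s D lam₁ Q']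
  exact ⟨fun h => congrArg _ h, fun h => fibrePointToLeft_injective s h⟩

/-- **The kernel of `λ_s` on `Ω`-points is the kernel set `K(λ̄)` of ★ `Polarization.kerPointsAt`.**
[cite: MumfordAV1970, §13 (the group K(L))] [cite: MumfordFogartyKirwan1994, Ch. 6 §2 Definition 6.3 (p. 120)] -/
theorem setOf_algPointsMap_fibreHom_eq_one_eq_kerPointsAt {D : A.DualPair} (pol : A.Polarization D) [IsMonHom pol.lam]
    (s : Spec (.of Ω) ⟶ S) :
    {P : (A.fibre s).toAbelianVariety.Points Ω | AlgPoints.map (fibreHom pol.lam s).hom.hom.hom P = 1} = pol.kerPointsAt s := by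
  ext P
  rw [Set.mem_setOf_eq, Polarization.mem_kerPointsAt_iff, ← algPointsMap_hom_one (fibreHom pol.lam s),
    algPointsMap_fibreHom_eq_iff A s D pol.lam pol.lam P 1]

/-- **A polarisation of type `δ` has FINITELY MANY `Ω`-points in the kernel of `λ_s`** (`Ω` algebraically closed): the kernel
on points is `K(λ̄) = kerPointsAt s`, the image of `(∏ᵢ ℤ/δᵢ)²` with all `δᵢ ≥ 1` (★ `Polarization.HasType`).
[cite: MumfordFogartyKirwan1994, App. 7A (pp. 234–235)] [cite: MumfordAV1970, §23] -/
theorem finite_ker_fibreHom_of_hasType {D : A.DualPair} (pol : A.Polarization D) [IsMonHom pol.lam] {g : ℕ} {δ : Fin g → ℕ}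
    (hT : pol.HasType δ) [IsAlgClosed Ω] (s : Spec (.of Ω) ⟶ S) :
    {P : (A.fibre s).toAbelianVariety.Points Ω | AlgPoints.map (fibreHom pol.lam s).hom.hom.hom P = 1}.Finite := by
  rw [setOf_algPointsMap_fibreHom_eq_one_eq_kerPointsAt pol s]
  obtain ⟨φ, -, hrange⟩ := Polarization.HasType.exists_mulHom pol hT Ω s
  rw [← hrange]
  haveI : ∀ i, NeZero (δ i) := fun i => ⟨(hT.1.1 i).ne'⟩
  exact Set.finite_range φ

end AbelianSchemeOver

end Literature.AlgebraicGeometry.AbelianSchemes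

end
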